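import Mathlib
import Summits.ValiantsHypothesis.ValiantsHypothesis.Theorems.RigidityForcesSymmetryRankRigidMinimalReprLaplaceFiveSeparatedCaptureTwoEqualPlusLine

/-!
# ValiantsHypothesis / RigidityForcesSymmetry — crux `LaplaceOptimalFive` (stmt-ValiantsHypothesis-24813), symmetric capture:
# ★★ **THE `(P, P, Q)` PROFILE OF `CaptureIneqSym` IN SUBMODULE CURRENCY** (two equal spans of `finrank ≤ 2` and a span of
# `finrank ≤ 2` meeting them in a line, not contained in them)

Wrapper of ★★ `finrank_le_six_of_two_equal_plus_line` (generators currency, ✓ `…SeparatedCaptureTwoEqualPlusLine`) for the K1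
consumer (val-port-2 g6 ↔ crit-3 g9, 2026-08-29): from `P ⊓ Q ≠ ⊥` and `¬ Q ≤ P` one reads generators `P = span {u, w}`,
`Q = span {u, v}` with `u ≠ 0`, `w ∉ Q` (`eq_span_pair_of_finrank_le_two`); the degenerate case `finrank P ≤ 1` (`P = ℂu ≤ Q`) is
✓ `captureIneqSym_of_two_lines` with equal lines.  The placements `(P, Q, P)` and `(Q, P, P)` follow by the slot symmetries
✓ `contractZ_mem_L3_swap23` / ✓ `contractZ_mem_L3_swap13`.

* `eq_span_pair_of_finrank_le_two` — a space of `finrank ≤ 2` containing two independent vectors is their span.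
* ★★ `captureIneqSym_of_two_equal_plus_line` — `finrank W ≤ finrank P + finrank P + finrank Q` for `W` captured by `L3 P P Q`.
* ★ `captureIneqSym_of_two_equal_plus_line_02`, `…_12` — the placements `L3 P Q P` and `L3 Q P P`.

Honest framing.  `(SC)` = `CaptureIneqSym` for the two-equal-plus-line profiles only; the common-line profile, every profile with a span of
`finrank ≥ 3` outside the landed cells, `CaptureIneqSym` in general, K1 on `K₃ ⊔ K₂`, `LaplaceOptimalFive` (OPEN · CONTESTED 72/120),
`RankRigidMinimalRepr` and `VP ≠ VNP` are NOT proved here.  No definitions, no `sorry`.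
-/

set_option linter.dupNamespace false
set_option autoImplicit false

namespace Summit.ValiantsHypothesis.ValiantsHypothesis.Theorems.RigidityForcesSymmetryRankRigidMinimalRepr

namespace LaplaceFiveSeparatedCapture

open Finset

/-- A space of `finrank ≤ 2` containing two linearly independent vectors `u, v` is `span {u, v}`. [folklore] -/
theorem eq_span_pair_of_finrank_le_two (S : Submodule ℂ (Fin 5 → Fin 5 → ℂ)) (hS : Module.finrank ℂ S ≤ 2)
    (u v : Fin 5 → Fin 5 → ℂ) (hu : u ∈ S) (hv : v ∈ S) (hind : ∀ s t : ℂ, s • u + t • v = 0 → s = 0 ∧ t = 0) :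
    S = Submodule.span ℂ ({u, v} : Set (Fin 5 → Fin 5 → ℂ)) := by
  classical
  have hle : Submodule.span ℂ ({u, v} : Set (Fin 5 → Fin 5 → ℂ)) ≤ S := by
    rw [Submodule.span_le]
    intro x hx
    simp only [Set.mem_insert_iff, Set.mem_singleton_iff] at hx
    rcases hx with rfl | rfl
    · exact hu
    · exact hv
  set Sp := Submodule.span ℂ ({u, v} : Set (Fin 5 → Fin 5 → ℂ)) with hSp
  have huS : u ∈ Sp := Submodule.subset_span (by simp)
  have hvS : v ∈ Sp := Submodule.subset_span (by simp)
  let f : Fin 2 → Sp := ![⟨u, huS⟩, ⟨v, hvS⟩]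
  have hf : LinearIndependent ℂ f := by
    rw [Fintype.linearIndependent_iff]
    intro g hg i
    have h0 := congrArg (fun z : Sp => (z : Fin 5 → Fin 5 → ℂ)) hg
    simp only [Fin.sum_univ_two, Submodule.coe_add, Submodule.coe_smul, Submodule.coe_zero, f, Matrix.cons_val_zero,
      Matrix.cons_val_one] at h0
    have h := hind (g 0) (g 1) h0
    fin_cases i
    · exact h.1
    · exact h.2
  have h2 : 2 ≤ Module.finrank ℂ Sp := by
    have := hf.fintype_card_le_finrank
    simpa using this
  exact (Submodule.eq_of_le_of_finrank_le hle (hS.trans h2)).symm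

/-- ★★ **`CaptureIneqSym` FOR THE PROFILE `(P, P, Q)`** (submodule currency): `P`, `Q` symmetric of `finrank ≤ 2` with
`P ⊓ Q ≠ ⊥` and `¬ Q ≤ P`; every `W` of symmetric zero-diagonal leaf matrices captured by `L3 P P Q` has
`finrank W ≤ finrank P + finrank P + finrank Q`. [folklore] -/
theorem captureIneqSym_of_two_equal_plus_line (P Q W : Submodule ℂ (Fin 5 → Fin 5 → ℂ))
    (hPs : ∀ x ∈ P, ∀ p q : Fin 5, x p q = x q p) (hQs : ∀ x ∈ Q, ∀ p q : Fin 5, x p q = x q p)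
    (hP2 : Module.finrank ℂ P ≤ 2) (hQ2 : Module.finrank ℂ Q ≤ 2) (hPQ : P ⊓ Q ≠ ⊥) (hQP : ¬ Q ≤ P)
    (hWs : ∀ μ ∈ W, ∀ s t : Fin 5, μ s t = μ t s) (hWd : ∀ μ ∈ W, ∀ s : Fin 5, μ s s = 0)
    (hWc : ∀ μ ∈ W, contractZ μ ∈ L3 P P Q) :
    Module.finrank ℂ W ≤ Module.finrank ℂ P + Module.finrank ℂ P + Module.finrank ℂ Q := by
  classical
  -- a nonzero `u` on the common line and a `v ∈ Q` off `P`
  obtain ⟨u, huPQ, hu0⟩ := Submodule.exists_mem_ne_zero_of_ne_bot hPQ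
  obtain ⟨huP, huQ⟩ := Submodule.mem_inf.mp huPQ
  obtain ⟨v, hvQ, hvP⟩ := SetLike.not_le_iff_exists.mp hQP
  have hu : ∀ p q, u p q = u q p := hPs u huP
  have hv : ∀ p q, v p q = v q p := hQs v hvQ
  have hindQ : ∀ s t : ℂ, s • u + t • v = 0 → s = 0 ∧ t = 0 := by
    intro s t hst
    by_cases ht : t = 0
    · rw [ht, zero_smul, add_zero] at hst
      exact ⟨(smul_eq_zero.mp hst).resolve_right hu0, ht⟩
    · exfalso
      apply hvP
      have e : v = (-(s / t)) • u := by
        have h2 : t • v = -(s • u) := eq_neg_of_add_eq_zero_right hst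
        have h3 := congrArg (fun z => t⁻¹ • z) h2
        simp only [smul_smul, inv_mul_cancel₀ ht, one_smul, smul_neg] at h3
        rw [h3, neg_smul, div_eq_inv_mul]
      rw [e]
      exact P.smul_mem _ huP
  have hQeq : Q = Submodule.span ℂ ({u, v} : Set (Fin 5 → Fin 5 → ℂ)) :=
    eq_span_pair_of_finrank_le_two Q hQ2 u v huQ hvQ hindQ
  have hQ2' : Module.finrank ℂ Q = 2 := by
    apply le_antisymm hQ2
    -- the independent pair inside `Q`
    let f : Fin 2 → Q := ![⟨u, huQ⟩, ⟨v, hvQ⟩]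
    have hf : LinearIndependent ℂ f := by
      rw [Fintype.linearIndependent_iff]
      intro g hg i
      have h0 := congrArg (fun z : Q => (z : Fin 5 → Fin 5 → ℂ)) hg
      simp only [Fin.sum_univ_two, Submodule.coe_add, Submodule.coe_smul, Submodule.coe_zero, f, Matrix.cons_val_zero,
        Matrix.cons_val_one] at h0
      have h' := hindQ (g 0) (g 1) h0
      fin_cases i
      · exact h'.1
      · exact h'.2
    have := hf.fintype_card_le_finrank
    simpa using this
  by_cases hP1 : Module.finrank ℂ P ≤ 1
  · -- `P = ℂu`: two equal lines and the span `Q`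
    have h1 : Module.finrank ℂ (ℂ ∙ u) = 1 := finrank_span_singleton hu0
    have hle : (ℂ ∙ u) ≤ P := (Submodule.span_singleton_le_iff_mem u P).mpr huP
    have heq : (ℂ ∙ u) = P := Submodule.eq_of_le_of_finrank_le hle (by omega)
    subst heq
    have := captureIneqSym_of_two_lines u u hu hu hu0 hu0 Q W hQs hQ2 hWs hWd hWc
    omega
  -- `finrank P = 2`: a `w ∈ P` off `Q`, `P = span {u, w}`
  push Not at hP1
  have hP2' : Module.finrank ℂ P = 2 := le_antisymm hP2 hP1
  have hPQ' : ¬ P ≤ Q := by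
    intro hle
    have heq : P = Q := Submodule.eq_of_le_of_finrank_le hle (by omega)
    exact hQP heq.ge
  obtain ⟨w, hwP, hwQ⟩ := SetLike.not_le_iff_exists.mp hPQ'
  have hw : ∀ p q, w p q = w q p := hPs w hwP
  have hindP : ∀ s t : ℂ, s • u + t • w = 0 → s = 0 ∧ t = 0 := by
    intro s t hst
    by_cases ht : t = 0
    · rw [ht, zero_smul, add_zero] at hst
      exact ⟨(smul_eq_zero.mp hst).resolve_right hu0, ht⟩
    · exfalso
      apply hwQ
      have e : w = (-(s / t)) • u := by
        have h2 : t • w = -(s • u) := eq_neg_of_add_eq_zero_right hst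
        have h3 := congrArg (fun z => t⁻¹ • z) h2
        simp only [smul_smul, inv_mul_cancel₀ ht, one_smul, smul_neg] at h3
        rw [h3, neg_smul, div_eq_inv_mul]
      rw [e]
      exact Q.smul_mem _ huQ
  have hPeq : P = Submodule.span ℂ ({u, w} : Set (Fin 5 → Fin 5 → ℂ)) :=
    eq_span_pair_of_finrank_le_two P hP2 u w huP hwP hindP
  have hwQ' : w ∉ Submodule.span ℂ ({u, v} : Set (Fin 5 → Fin 5 → ℂ)) := hQeq ▸ hwQ
  rw [hP2', hQ2']
  rw [hPeq, hQeq] at hWc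
  have := finrank_le_six_of_two_equal_plus_line u w v hu hw hv hu0 hwQ' W hWs hWd hWc
  omega

/-- ★ The placement `(P, Q, P)`: `W` captured by `L3 P Q P` (✓ `contractZ_mem_L3_swap23`). [folklore] -/
theorem captureIneqSym_of_two_equal_plus_line_02 (P Q W : Submodule ℂ (Fin 5 → Fin 5 → ℂ))
    (hPs : ∀ x ∈ P, ∀ p q : Fin 5, x p q = x q p) (hQs : ∀ x ∈ Q, ∀ p q : Fin 5, x p q = x q p)
    (hP2 : Module.finrank ℂ P ≤ 2) (hQ2 : Module.finrank ℂ Q ≤ 2) (hPQ : P ⊓ Q ≠ ⊥) (hQP : ¬ Q ≤ P)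
    (hWs : ∀ μ ∈ W, ∀ s t : Fin 5, μ s t = μ t s) (hWd : ∀ μ ∈ W, ∀ s : Fin 5, μ s s = 0)
    (hWc : ∀ μ ∈ W, contractZ μ ∈ L3 P Q P) :
    Module.finrank ℂ W ≤ Module.finrank ℂ P + Module.finrank ℂ Q + Module.finrank ℂ P := by
  have hWc' : ∀ μ ∈ W, contractZ μ ∈ L3 P P Q := fun μ hμ => contractZ_mem_L3_swap23 P Q P hPs μ (hWc μ hμ)
  have := captureIneqSym_of_two_equal_plus_line P Q W hPs hQs hP2 hQ2 hPQ hQP hWs hWd hWc'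
  omega

/-- ★ The placement `(Q, P, P)`: `W` captured by `L3 Q P P` (✓ `contractZ_mem_L3_swap13`). [folklore] -/
theorem captureIneqSym_of_two_equal_plus_line_12 (P Q W : Submodule ℂ (Fin 5 → Fin 5 → ℂ))
    (hPs : ∀ x ∈ P, ∀ p q : Fin 5, x p q = x q p) (hQs : ∀ x ∈ Q, ∀ p q : Fin 5, x p q = x q p)
    (hP2 : Module.finrank ℂ P ≤ 2) (hQ2 : Module.finrank ℂ Q ≤ 2) (hPQ : P ⊓ Q ≠ ⊥) (hQP : ¬ Q ≤ P)
    (hWs : ∀ μ ∈ W, ∀ s t : Fin 5, μ s t = μ t s) (hWd : ∀ μ ∈ W, ∀ s : Fin 5, μ s s = 0)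
    (hWc : ∀ μ ∈ W, contractZ μ ∈ L3 Q P P) :
    Module.finrank ℂ W ≤ Module.finrank ℂ Q + Module.finrank ℂ P + Module.finrank ℂ P := by
  have hWc' : ∀ μ ∈ W, contractZ μ ∈ L3 P P Q := fun μ hμ => contractZ_mem_L3_swap13 Q P P hQs hPs hPs μ (hWc μ hμ)
  have := captureIneqSym_of_two_equal_plus_line P Q W hPs hQs hP2 hQ2 hPQ hQP hWs hWd hWc'
  omega

end LaplaceFiveSeparatedCapture

end Summit.ValiantsHypothesis.ValiantsHypothesis.Theorems.RigidityForcesSymmetryRankRigidMinimalRepr
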